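import Summits.Ventures.CertifiedManyBodySolver.Rows.CorrWindowCertKernelIdentity
import HarnessLib

/-!
# KERNEL FORM with a SEMANTIC RESIDUAL hypothesis — the entry point for STAGED (chunked) kernel replays

HONEST FRAMING: Lean plumbing towards «tier P». MEASURED (seat g22, farm scratch, HOME/STATUS «MEASUREMENT + CAVEAT TO (C) ITEM
(iv)»): one `decide +kernel` declaration holds a normal form of at most ≈ 10⁴ monomials on a 12-GB build lane, so no real La214
certificate passes through `affineOrbitLowerRowN_of_kernelCert{,G,TB}` in ONE call — the residual must be consumed slice by slice on
an encoded accumulator (the quantum-chemistry cell's pattern, `CertifiedQuantumChemistry/Rows/SOSDualMerge.lean`), and the END of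
such a chain is a polynomial `R` with `evalPoly d R = termOp d residTG` that is NOT syntactically `normalize enc B residTG`. This file
re-states the identity level and the kernel theorem with exactly that SEMANTIC hypothesis (`hRsem`), so any staging discipline
(encoded merge chain, run merging, segmented ℓ¹) plugs in by proving `hRsem` from its per-step kernel facts; the price is still
`lowerConst R` (valid for ANY polynomial denoting the residual: `constCoeff R − Σ‖resCoeff R‖ = lowerConst R`; an uncollected `R`
only makes the bound weaker, never unsound). Nothing of record moves; no claim node is discharged; CONTROL/CALIBRATION context
(wording (xx1)); no summit statement is proved by this file. Seat hubbard-obs-p2 (STIFFNESS), `prover-hubbard-obs-p2-g22-0`, zero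
compute.

Contents: `windowIdentity_of_residPoly` (the `…_affine₂` `hcert` identity from `hRsem`), `affineOrbitLowerRowN_of_residPolyG`
(the claim-node predicate from `hRsem` + `q ≤ lowerConst R + (μ0+μ1)(n₀/2−ν)`, abstract Gram slot).

References: J. Wang et al., PRX 14 (2024) 031006 §III [WangEtAl2024]; X. Han, arXiv:2006.06002 §3 [Han2020Bootstrap]; C. Jansson,
D. Chaykin, C. Keil, SIAM J. Numer. Anal. 46 (2008) 180 [JanssonChaykinKeil2008].
-/

noncomputable section

namespace Summit.Ventures.CertifiedManyBodySolver

namespace CARPolyWindow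

open Summit.Ventures.CertifiedQuantumChemistry Summit.Ventures.CertifiedQuantumChemistry.CARPoly
open Literature.MathematicalPhysics.QuantumLattice Literature.MathematicalPhysics.QuantumLattice.HubbardWave0
open Literature.MathematicalPhysics.QuantumManyBody.StateRelaxation
open Literature.Probability.LatticeModels ThermodynamicLimit Filter Topology
open Matrix
open scoped ComplexOrder BigOperators

section SemanticResidual

variable {α β : Type*}

/-- **KERNEL FORM, IDENTITY LEVEL, SEMANTIC RESIDUAL: the window-certificate operator identity `hcert` (binder shape of
`…_TT'_affine₂`) from the syntactic residual `residTG` and ANY polynomial `R` that DENOTES it (`evalPoly d R = termOp d residTG`)** —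
the collected normal form (`windowIdentity_of_residTG`, via `evalPoly_normalize'`) and the decoded end of a staged encoded merge chain
are both instances; constant `c := constCoeff R`, residual family `(resCoeff R, resWord d R)`. [cite: WangEtAl2024, §III]
[cite: JanssonChaykinKeil2008, §3] -/
theorem windowIdentity_of_residPoly
    {Λ Λ' : Finset (Site 2)} (hΛ : Λ ⊆ Λ') (hz : (0 : Site 2) ∈ Λ')
    -- letters
    (d : α → Orb (PolySite Λ'))
    (dΛ : β → Orb (PolySite Λ)) (f : β → α) (hf : ∀ b, d (f b) = Orb.embMap (PolySite.incl hΛ) (dΛ b))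
    -- dictionaries (abstract)
    (TH : Terms α) (Hsem : FermionOp Λ') (hH : termOp d TH = Hsem)
    (TE : Terms α) (Esem : FermionOp Λ') (hE : termOp d TE = Esem)
    (o : Fin 2 → α) (ho : ∀ σ, d (o σ) = orb (PolySite.pt 0 hz) σ)
    -- certificate data
    (TX : Terms α) (μ : Fin 2 → ℚ) (ν κhi hi κlo lo : ℚ)
    (TG : Terms α) {m : Type*} [Fintype m] [DecidableEq m] (Λm : Matrix m m ℂ) (O : m → FermionOp Λ')
    (hTG : termOp d TG = gramForm Λm O) (EB : List (Terms β))
    {nS : ℕ} (γ : Fin nS → DihedralGroup 4) (wv : Fin nS → Site 2)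
    (hsh : ∀ l, d4ShiftSet (γ l) (wv l) Λ ⊆ Λ') (g : Fin nS → β → α)
    (hg : ∀ l b, d (g l b) = Orb.embMap (PolySite.incl (hsh l)) (Orb.embMap (PolySite.d4Emb (γ l) (wv l) Λ) (dΛ b)))
    (SY : Fin nS → Terms β) (CW : Terms α) (AV : List (Terms α))
    -- ANY polynomial denoting the residual (a collected normal form, or the decoded end of a staged merge chain)
    {R : CARPoly.Poly α} (hRsem : evalPoly d R = termOp d (residTG TX μ ν o κhi hi κlo lo TE TG TH f EB g SY CW AV)) :
    termOp d TX - (((constCoeff R : ℚ) : ℝ) : ℂ) • (1 : FermionOp Λ') -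
        ∑ σ : Fin 2, (((μ σ : ℚ) : ℝ) : ℂ) • (nAt 0 hz σ - (((ν : ℚ) : ℝ) : ℂ) • (1 : FermionOp Λ')) -
        (((κhi : ℚ) : ℝ) : ℂ) • ((((hi : ℚ) : ℝ) : ℂ) • (1 : FermionOp Λ') - Esem) -
        (((κlo : ℚ) : ℝ) : ℂ) • (Esem - (((lo : ℚ) : ℝ) : ℂ) • (1 : FermionOp Λ')) =
      gramForm Λm O +
        (∑ k ∈ (Finset.univ : Finset (Fin EB.length)),
            (Hsem * fermionEmbed (PolySite.incl hΛ) (termOp dΛ (EB.get k)) -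
              fermionEmbed (PolySite.incl hΛ) (termOp dΛ (EB.get k)) * Hsem) +
          ∑ l ∈ (Finset.univ : Finset (Fin nS)),
            (fermionEmbed (PolySite.incl (hsh l)) (fermionEmbed (PolySite.d4Emb (γ l) (wv l) Λ) (termOp dΛ (SY l))) -
              fermionEmbed (PolySite.incl hΛ) (termOp dΛ (SY l))) +
          ∑ j ∈ (Finset.univ : Finset (Fin CW.length)), (((CW.get j).2 : ℚ) : ℂ) • ladderWord (wmap d (CW.get j).1)) +
        (∑ m' ∈ (Finset.univ : Finset (Fin AV.length)),
            (((1 : ℝ) : ℝ) : ℂ) • ((termOp d (AV.get m'))ᴴ - termOp d (AV.get m')) +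
          ∑ k ∈ (Finset.univ : Finset (Fin R.length)), resCoeff R k • ladderWord (resWord d R k)) := by
  -- names for the semantic pieces
  set Dn : FermionOp Λ' := ∑ σ : Fin 2, (((μ σ : ℚ) : ℝ) : ℂ) • (nAt 0 hz σ - (((ν : ℚ) : ℝ) : ℂ) • (1 : FermionOp Λ'))
    with hDn
  set Er : FermionOp Λ' := (((κhi : ℚ) : ℝ) : ℂ) • ((((hi : ℚ) : ℝ) : ℂ) • (1 : FermionOp Λ') - Esem) +
      (((κlo : ℚ) : ℝ) : ℂ) • (Esem - (((lo : ℚ) : ℝ) : ℂ) • (1 : FermionOp Λ')) with hEr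
  set G : FermionOp Λ' := gramForm Λm O with hG
  set EOM : FermionOp Λ' := ∑ k ∈ (Finset.univ : Finset (Fin EB.length)),
      (Hsem * fermionEmbed (PolySite.incl hΛ) (termOp dΛ (EB.get k)) -
        fermionEmbed (PolySite.incl hΛ) (termOp dΛ (EB.get k)) * Hsem) with hEOM
  set SYM : FermionOp Λ' := ∑ l ∈ (Finset.univ : Finset (Fin nS)),
      (fermionEmbed (PolySite.incl (hsh l)) (fermionEmbed (PolySite.d4Emb (γ l) (wv l) Λ) (termOp dΛ (SY l))) -
        fermionEmbed (PolySite.incl hΛ) (termOp dΛ (SY l))) with hSYM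
  set CHG : FermionOp Λ' := ∑ j ∈ (Finset.univ : Finset (Fin CW.length)),
      (((CW.get j).2 : ℚ) : ℂ) • ladderWord (wmap d (CW.get j).1) with hCHG
  set AH : FermionOp Λ' := ∑ m' ∈ (Finset.univ : Finset (Fin AV.length)),
      (((1 : ℝ) : ℝ) : ℂ) • ((termOp d (AV.get m'))ᴴ - termOp d (AV.get m')) with hAH
  set RES : FermionOp Λ' := ∑ k ∈ (Finset.univ : Finset (Fin R.length)), resCoeff R k • ladderWord (resWord d R k)
    with hRES
  have ec : ∀ r : ℚ, ((((r : ℚ) : ℝ) : ℝ) : ℂ) = ((r : ℚ) : ℂ) := fun r => Complex.ofReal_ratCast r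
  -- (1) what the residual denotes
  have key : termOp d (residTG TX μ ν o κhi hi κlo lo TE TG TH f EB g SY CW AV) =
      termOp d TX - Dn - Er - G - EOM - SYM - CHG - AH := by
    have hD : termOp d ((finL 2).flatMap fun σ => scaleT (μ σ) (densT o ν σ)) = Dn := by
      rw [termOp_flatMap_finL, hDn]
      refine Finset.sum_congr rfl fun σ _ => ?_
      rw [termOp_scaleT, termOp_densT d hz o ho, ec, ec]
    have hEr' : termOp d (scaleT κhi (unitT hi ++ negT TE)) + termOp d (scaleT κlo (TE ++ unitT (-lo))) = Er := by
      rw [termOp_scaleT, termOp_scaleT, termOp_append, termOp_append, termOp_negT, termOp_unitT, termOp_unitT, hE,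
        hEr, ec, ec, ec, ec, Rat.cast_neg, neg_smul, ← sub_eq_add_neg, ← sub_eq_add_neg]
    have hGr : termOp d TG = G := by rw [hG, hTG]
    have hEo : termOp d (eomTβ TH f EB) = EOM := by
      rw [termOp_eomTβ hΛ d dΛ f hf, hH, hEOM]
    have hSy : termOp d (symT f g SY) = SYM := by
      rw [termOp_symT hΛ d dΛ f hf γ wv hsh g hg, hSYM]
    have hCh : termOp d CW = CHG := by rw [termOp_eq_sum_get, hCHG]
    have hAh : termOp d (ahT AV) = AH := by rw [termOp_ahT, hAH]
    rw [residTG, termOp_append, termOp_append, termOp_append, termOp_append, termOp_append, termOp_append, termOp_append,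
      termOp_append, termOp_negT, termOp_negT, termOp_negT, termOp_negT, termOp_negT, termOp_negT, termOp_negT, termOp_negT,
      hD, hGr, hEo, hSy, hCh, hAh, ← hEr']
    abel
  -- (2) the collected normal form denotes the same operator and splits into constant + residual family
  have hsplit : termOp d TX - Dn - Er - G - EOM - SYM - CHG - AH =
      ((((constCoeff R : ℚ) : ℝ) : ℝ) : ℂ) • (1 : FermionOp Λ') + RES := by
    rw [← key, ← hRsem, ec, hRES]
    exact evalPoly_eq_const_add_residual d R
  -- (3) rearrange
  rw [← sub_eq_zero]
  have e : termOp d TX - ((((constCoeff R : ℚ) : ℝ) : ℝ) : ℂ) • (1 : FermionOp Λ') - Dn -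
        (((κhi : ℚ) : ℝ) : ℂ) • ((((hi : ℚ) : ℝ) : ℂ) • (1 : FermionOp Λ') - Esem) -
        (((κlo : ℚ) : ℝ) : ℂ) • (Esem - (((lo : ℚ) : ℝ) : ℂ) • (1 : FermionOp Λ')) -
        (G + (EOM + SYM + CHG) + (AH + RES)) =
      (termOp d TX - Dn - Er - G - EOM - SYM - CHG - AH) -
        (((((constCoeff R : ℚ) : ℝ) : ℝ) : ℂ) • (1 : FermionOp Λ') + RES) := by
    rw [hEr]; abel
  rw [e, hsplit, sub_self]


/-- **KERNEL FORM, SEMANTIC RESIDUAL: syntactic window certificate (abstract Gram slot) + ANY polynomial `R` denoting the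
residual (`evalPoly d R = termOp d residTG` — e.g. the decoded end of a staged encoded merge chain, one `decide +kernel` per step) +
`q ≤ lowerConst R + (Σμ)(n₀/2 − ν)` ⇒ the affine-N claim-node predicate**
`SquareTTPrimeCorrAffineOrbitLowerRowN tp U q hi lo κhi κlo s n₀ S Λ' (termOp d TX)`; `affineOrbitLowerRowN_of_kernelCertG` is the
instance `R := normalize enc B residTG`. [cite: WangEtAl2024, §III] [cite: JanssonChaykinKeil2008, §3] -/
theorem affineOrbitLowerRowN_of_residPolyG
    (tp U : ℚ) (hU : 0 ≤ U)
    {Λ Λ' : Finset (Site 2)} (hΛ : Λ ⊆ Λ') (h8 : thicken Λ 1 ⊆ Λ')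
    (h0 : thicken ({0} : Finset (Site 2)) 1 ⊆ Λ') (hz : (0 : Site 2) ∈ Λ')
    {S : Finset (DihedralGroup 4)} (h1 : (1 : DihedralGroup 4) ∈ S) (hmul : ∀ a ∈ S, ∀ b ∈ S, a * b ∈ S)
    -- letters
    (d : α → Orb (PolySite Λ'))
    (dΛ : β → Orb (PolySite Λ)) (f : β → α) (hf : ∀ b, d (f b) = Orb.embMap (PolySite.incl hΛ) (dΛ b))
    (sp : α → Fin 2) (hsp : ∀ a, (ofLex (d a)).2 = sp a)
    -- dictionaries
    (TH : Terms α) (hH : termOp d TH = (hubbardTTPrimeFermionInteraction 1 tp U).localHamiltonian Λ')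
    (TE : Terms α)
    (hE : termOp d TE = fermionEmbed (PolySite.incl h0) ((hubbardTTPrimeFermionInteraction 1 tp U).meanEnergyObs 1))
    (o : Fin 2 → α) (ho : ∀ σ, d (o σ) = orb (PolySite.pt 0 hz) σ)
    -- certificate data
    (TX : Terms α) (μ : Fin 2 → ℚ) (ν κhi hi κlo lo : ℚ)
    (TG : Terms α) {m : Type*} [Fintype m] [DecidableEq m] {Λm : Matrix m m ℂ} (hΛm : Λm.PosSemidef)
    (O : m → FermionOp Λ') (hTG : termOp d TG = gramForm Λm O) (EB : List (Terms β))
    {nS : ℕ} (γ : Fin nS → DihedralGroup 4) (hγS : ∀ l, γ l ∈ S) (wv : Fin nS → Site 2)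
    (hsh : ∀ l, d4ShiftSet (γ l) (wv l) Λ ⊆ Λ') (g : Fin nS → β → α)
    (hg : ∀ l b, d (g l b) = Orb.embMap (PolySite.incl (hsh l)) (Orb.embMap (PolySite.d4Emb (γ l) (wv l) Λ) (dΛ b)))
    (SY : Fin nS → Terms β)
    (CW : Terms α) (hcw : ∀ wc ∈ CW, chargeW wc.1 ≠ 0 ∨ spinChargeW sp wc.1 ≠ 0)
    (AV : List (Terms α))
    -- the ONE rational inequality
    {R : CARPoly.Poly α} (hRsem : evalPoly d R = termOp d (residTG TX μ ν o κhi hi κlo lo TE TG TH f EB g SY CW AV))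
    {q s n₀ : ℚ} (hs : s = (μ 0 + μ 1) / 2)
    (hq : q ≤ lowerConst R + (μ 0 + μ 1) * (n₀ / 2 - ν)) :
    SquareTTPrimeCorrAffineOrbitLowerRowN (tp : ℝ) (U : ℝ) q hi lo κhi κlo s n₀ S Λ' (termOp d TX) := by
  intro x hx0 hx2 ω Ls ψ hLs hψ hψ1 hω
  have hUr : (0 : ℝ) ≤ ((U : ℚ) : ℝ) := by exact_mod_cast hU
  have hcert := windowIdentity_of_residPoly hΛ hz d dΛ f hf TH _ hH TE _ hE o ho TX μ ν κhi hi κlo lo TG Λm O hTG EB γ wv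
    hsh g hg SY CW AV hRsem
  have hmain := hω.re_sum_expect_d4_ge_of_window_certificate_TT'_affine₂ 1 ((tp : ℚ) : ℝ) hUr hx0 hx2
    ((κhi : ℚ) : ℝ) ((hi : ℚ) : ℝ) ((κlo : ℚ) : ℝ) ((lo : ℚ) : ℝ) hΛ h8 h0 hz h1 hmul (termOp d TX)
    (fun σ => ((μ σ : ℚ) : ℝ)) ((ν : ℚ) : ℝ) hΛm O Finset.univ (fun k => termOp dΛ (EB.get k)) Finset.univ γ
    (fun l _ => hγS l) wv hsh (fun l => termOp dΛ (SY l)) Finset.univ (fun j => (((CW.get j).2 : ℚ) : ℂ))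
    (fun j => wmap d (CW.get j).1) (charged_of_hcw d sp hsp CW hcw) Finset.univ (fun _ => (1 : ℝ))
    (fun m' => termOp d (AV.get m')) Finset.univ (resCoeff R) (resWord d R) hcert hLs hψ hψ1
  -- the price is `lowerConst R`
  have hlc := constCoeff_sub_sum_norm_resCoeff R
  have hμ : (∑ σ : Fin 2, ((μ σ : ℚ) : ℝ)) = ((μ 0 : ℚ) : ℝ) + ((μ 1 : ℚ) : ℝ) := Fin.sum_univ_two _
  have e2 : (((μ 0 : ℚ) : ℝ) + ((μ 1 : ℚ) : ℝ)) * (x / 2 - ((ν : ℚ) : ℝ)) =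
      (((μ 0 : ℚ) : ℝ) + ((μ 1 : ℚ) : ℝ)) * (((n₀ : ℚ) : ℝ) / 2 - ((ν : ℚ) : ℝ)) +
        (((μ 0 : ℚ) : ℝ) + ((μ 1 : ℚ) : ℝ)) / 2 * (x - ((n₀ : ℚ) : ℝ)) := by
    ring
  rw [hμ, e2, hlc] at hmain
  have hq' : ((q : ℚ) : ℝ) ≤ ((lowerConst R : ℚ) : ℝ) +
      (((μ 0 : ℚ) : ℝ) + ((μ 1 : ℚ) : ℝ)) * (((n₀ : ℚ) : ℝ) / 2 - ((ν : ℚ) : ℝ)) := by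
    have h2 : ((q : ℚ) : ℝ) ≤ (((lowerConst R + (μ 0 + μ 1) * (n₀ / 2 - ν) : ℚ)) : ℝ) := by exact_mod_cast hq
    push_cast at h2
    linarith
  have hs' : ((s : ℚ) : ℝ) = (((μ 0 : ℚ) : ℝ) + ((μ 1 : ℚ) : ℝ)) / 2 := by
    rw [hs]; push_cast; ring
  rw [hs']
  linarith


end SemanticResidual

end CARPolyWindow

end Summit.Ventures.CertifiedManyBodySolver

end
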